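import Summits.Parity.GeneralizedHardyLittlewood.Theorems.LeeYangFibresRelativeDimOneTypeDefs
import Summits.Parity.GeneralizedHardyLittlewood.Theorems.LeeYangFibresRelativeDimOneSplitEulerExpansion
import Summits.Parity.GeneralizedHardyLittlewood.Theorems.LeeYangFibresRelativeDimOneSplitLocalIdentity
import Summits.Parity.GeneralizedHardyLittlewood.Theorems.LeeYangFibresRelativeDimOneSplitTranslation
import HarnessLib

/-!
# Route `LeeYangFibres`, crux `RelativeDimOne` (stmt-Parity-14113), line `gallagher-backwards-split` (RESHAPED,
# type-conditioned split): singular-weight fact (W5) for the stub `stub_singularWeights`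

(W5) THE COPRIME DENSITY ON A TYPE CLASS IS THE LOCAL FACTOR: for `q ≥ 1`, a target `b₀` and every shift `n`,

  `#{c ∈ class(b₀ mod q) : gcd(a_i n + c_i, q) = 1 ∀ i} · q^t = #class · φ(q)^t · ∏_{p ∣ q} β_p(a, b₀)`,

where `class(b₀ mod q) = typeCell q q a b₀` is the set of residue vectors `c ∈ [0, q)^t` whose incidence types agree
with those of `b₀` at every `p ∣ q`.

Proof. The landed local identity `card_coprime_classes_eq` gives, for each `c`,
`#{r < q : gcd(a_i r + c_i, q) = 1 ∀ i} · q^t = q · φ(q)^t · ∏_{p∣q} β_p(a, c)`, and `∏_{p∣q} β_p(a, c) = ∏_{p∣q} β_p(a, b₀)`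
on the class (`localFactor_sys_eq_of_incType_eq`). Summing over the class and double counting the pairs `(c, r)`,
it remains to see that `#{c ∈ class : gcd(a_i r + c_i, q) = 1 ∀ i}` does not depend on `r`: the map
`c ↦ (c + (r − n) a) mod q` is an injection of the class into itself (`incType` is translation invariant,
`incType_translate`, and only depends on residues, `incType_congr_mod`) carrying "coprime at `r`" to "coprime at `n`".
-/

noncomputable section

open scoped BigOperators Classical
open Finset Literature.NumberTheory.Sieve
open Summit.Parity.GeneralizedHardyLittlewood.Cruxes.RelativeDimOne.GallagherBackwardsSplit

namespace Summit.Parity.GeneralizedHardyLittlewood.Cruxes.RelativeDimOne.TypeSplit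

variable {t : ℕ}

namespace SingularWeights

/-! ### Incidence types and residues -/

/-- The incidence type modulo `q` only depends on the shift vector modulo `q`. -/
theorem incType_congr_mod (q : ℕ) (a : Fin t → ℤ) {b b' : Fin t → ℤ} (h : ∀ i, b i ≡ b' i [ZMOD q]) :
    incType q a b = incType q a b' := by
  unfold incType
  refine Prod.ext ?_ ?_
  · funext i
    refine Prod.ext rfl ?_
    dsimp only
    have hg : ((Int.gcd (a i) q : ℕ) : ℤ) ∣ (q : ℤ) := Int.gcd_dvd_right _ _
    have hi : b i ≡ b' i [ZMOD ((Int.gcd (a i) q : ℕ) : ℤ)] := (h i).of_dvd hg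
    rw [← Int.gcd_emod, hi.eq, Int.gcd_emod]
  · funext i j
    dsimp only
    have hij : a i * b j - a j * b i ≡ a i * b' j - a j * b' i [ZMOD q] :=
      ((h j).mul_left _).sub ((h i).mul_left _)
    rw [← Int.gcd_emod, hij.eq, Int.gcd_emod]

/-- Membership in a type cell, unfolded. -/
theorem mem_typeCell {q w : ℕ} {a b₀ : Fin t → ℤ} {c : Fin t → ℕ} :
    c ∈ typeCell q w a b₀ ↔ c ∈ Fintype.piFinset (fun _ : Fin t => range q) ∧
      ∀ p ∈ q.primeFactors, p ≤ w → incType p a (fun i => (c i : ℤ)) = incType p a b₀ := by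
  unfold typeCell
  exact Finset.mem_filter

/-! ### The translate `c ↦ (c + s·a) mod q` of a residue vector -/

/-- The translate `c ↦ (c + s·a) mod q` of a residue vector stays in `[0, q)^t`. -/
theorem shift_mem_piFinset {q : ℕ} (hq : 0 < q) (a : Fin t → ℤ) (s : ℤ) (c : Fin t → ℕ) :
    (fun i => ((((c i : ℕ) : ℤ) + s * a i) % (q : ℤ)).toNat) ∈ Fintype.piFinset (fun _ : Fin t => range q) :=
  Fintype.mem_piFinset.mpr fun _ => mem_range.mpr (toNat_emod_lt hq _)

/-- The translate is congruent to `c + s·a` modulo `q`. -/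
theorem shift_modEq {q : ℕ} (hq : 0 < q) (a : Fin t → ℤ) (s : ℤ) (c : Fin t → ℕ) (i : Fin t) :
    ((((((c i : ℕ) : ℤ) + s * a i) % (q : ℤ)).toNat : ℕ) : ℤ) ≡ ((c i : ℕ) : ℤ) + s * a i [ZMOD q] := by
  rw [toNat_emod_cast hq]
  exact Int.mod_modEq _ _

/-- The translate of a vector of the type cell of `b₀ mod q` lies in the same cell (types are translation
invariant and only depend on residues). -/
theorem shift_mem_typeCell {q : ℕ} (hq : 0 < q) (a b₀ : Fin t → ℤ) (s : ℤ) {c : Fin t → ℕ}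
    (hc : c ∈ typeCell q q a b₀) :
    (fun i => ((((c i : ℕ) : ℤ) + s * a i) % (q : ℤ)).toNat) ∈ typeCell q q a b₀ := by
  rw [mem_typeCell] at hc ⊢
  refine ⟨shift_mem_piFinset hq a s c, fun p hp hpq => ?_⟩
  have hpd : (p : ℤ) ∣ (q : ℤ) := Int.natCast_dvd_natCast.mpr (Nat.dvd_of_mem_primeFactors hp)
  rw [← hc.2 p hp hpq]
  calc incType p a (fun i => (((((((c i : ℕ) : ℤ) + s * a i) % (q : ℤ)).toNat : ℕ) : ℤ)))
      = incType p a (fun i => ((c i : ℕ) : ℤ) + s * a i) :=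
        incType_congr_mod p a fun i => (shift_modEq hq a s c i).of_dvd hpd
    _ = incType p a (fun i => ((c i : ℕ) : ℤ)) := incType_translate p a (fun i => ((c i : ℕ) : ℤ)) s

/-- Coprimality along the translate: `gcd(a_i n + ((c + s a) mod q)_i, q) = gcd(a_i (n + s) + c_i, q)`. -/
theorem gcd_shift_eq {q : ℕ} (hq : 0 < q) (a : Fin t → ℤ) (s : ℤ) (c : Fin t → ℕ) (n : ℤ) (i : Fin t) :
    Int.gcd (a i * n + ((((((c i : ℕ) : ℤ) + s * a i) % (q : ℤ)).toNat : ℕ) : ℤ)) q =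
      Int.gcd (a i * (n + s) + ((c i : ℕ) : ℤ)) q := by
  have h : a i * n + ((((((c i : ℕ) : ℤ) + s * a i) % (q : ℤ)).toNat : ℕ) : ℤ) ≡
      a i * (n + s) + ((c i : ℕ) : ℤ) [ZMOD q] := by
    have h1 := (shift_modEq hq a s c i).add_left (a i * n)
    have e : a i * n + (((c i : ℕ) : ℤ) + s * a i) = a i * (n + s) + ((c i : ℕ) : ℤ) := by ring
    rwa [e] at h1
  rw [← Int.gcd_emod, h.eq, Int.gcd_emod]

/-- The translate is injective on `[0, q)^t`. -/
theorem shift_injOn {q : ℕ} (hq : 0 < q) (a : Fin t → ℤ) (s : ℤ) :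
    Set.InjOn (fun c : Fin t → ℕ => fun i => ((((c i : ℕ) : ℤ) + s * a i) % (q : ℤ)).toNat)
      (Fintype.piFinset (fun _ : Fin t => range q) : Finset (Fin t → ℕ)) := by
  intro c hc c' hc' h
  funext i
  have hci : c i < q := mem_range.mp (Fintype.mem_piFinset.mp (Finset.mem_coe.mp hc) i)
  have hci' : c' i < q := mem_range.mp (Fintype.mem_piFinset.mp (Finset.mem_coe.mp hc') i)
  have hi : ((((c i : ℕ) : ℤ) + s * a i) % (q : ℤ)).toNat = ((((c' i : ℕ) : ℤ) + s * a i) % (q : ℤ)).toNat :=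
    congr_fun h i
  have hi' : (((c i : ℕ) : ℤ) + s * a i) % (q : ℤ) = (((c' i : ℕ) : ℤ) + s * a i) % (q : ℤ) := by
    rw [← toNat_emod_cast hq (((c i : ℕ) : ℤ) + s * a i), ← toNat_emod_cast hq (((c' i : ℕ) : ℤ) + s * a i), hi]
  have hmod : ((c i : ℕ) : ℤ) ≡ ((c' i : ℕ) : ℤ) [ZMOD q] := Int.ModEq.add_right_cancel' (s * a i) hi'
  have h1 : ((c i : ℕ) : ℤ) % q = ((c i : ℕ) : ℤ) := Int.emod_eq_of_lt (by positivity) (by exact_mod_cast hci)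
  have h2 : ((c' i : ℕ) : ℤ) % q = ((c' i : ℕ) : ℤ) := Int.emod_eq_of_lt (by positivity) (by exact_mod_cast hci')
  have h3 : ((c i : ℕ) : ℤ) = ((c' i : ℕ) : ℤ) := by rw [← h1, ← h2]; exact hmod
  exact_mod_cast h3

/-! ### The coprime count on a type class does not depend on the shift -/

/-- TRANSLATION INVARIANCE OF THE COPRIME COUNT ON A TYPE CLASS (one inequality): inject
`{c ∈ cell : gcd(a_i r + c_i, q) = 1 ∀ i}` into `{c ∈ cell : gcd(a_i n + c_i, q) = 1 ∀ i}` by `c ↦ (c + (r − n) a) mod q`. -/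
theorem card_filter_coprime_le {q : ℕ} (hq : 0 < q) (a b₀ : Fin t → ℤ) (r n : ℤ) :
    #((typeCell q q a b₀).filter (fun c => ∀ i, Int.gcd (a i * r + c i) q = 1)) ≤
      #((typeCell q q a b₀).filter (fun c => ∀ i, Int.gcd (a i * n + c i) q = 1)) := by
  refine Finset.card_le_card_of_injOn
    (fun c : Fin t → ℕ => fun i => ((((c i : ℕ) : ℤ) + (r - n) * a i) % (q : ℤ)).toNat)
    (fun c hc => ?_) (fun c hc c' hc' h => ?_)
  · rw [Finset.mem_coe, Finset.mem_filter] at hc ⊢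
    refine ⟨shift_mem_typeCell hq a b₀ (r - n) hc.1, fun i => ?_⟩
    rw [gcd_shift_eq hq a (r - n) c n i, show n + (r - n) = r by ring]
    exact hc.2 i
  · have hc1 : c ∈ Fintype.piFinset (fun _ : Fin t => range q) :=
      (mem_typeCell.mp (Finset.mem_filter.mp (Finset.mem_coe.mp hc)).1).1
    have hc1' : c' ∈ Fintype.piFinset (fun _ : Fin t => range q) :=
      (mem_typeCell.mp (Finset.mem_filter.mp (Finset.mem_coe.mp hc')).1).1
    exact shift_injOn hq a (r - n) (Finset.mem_coe.mpr hc1) (Finset.mem_coe.mpr hc1') h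

/-- The coprime count on the type class is the same at every shift. -/
theorem card_filter_coprime_eq {q : ℕ} (hq : 0 < q) (a b₀ : Fin t → ℤ) (r n : ℤ) :
    #((typeCell q q a b₀).filter (fun c => ∀ i, Int.gcd (a i * r + c i) q = 1)) =
      #((typeCell q q a b₀).filter (fun c => ∀ i, Int.gcd (a i * n + c i) q = 1)) :=
  le_antisymm (card_filter_coprime_le hq a b₀ r n) (card_filter_coprime_le hq a b₀ n r)

/-- On the type class of `b₀ mod q` the local type factor is constant (`β_p` is a function of the incidence type). -/
theorem localTypeFactor_eq_of_mem_typeCell {q : ℕ} (a b₀ : Fin t → ℤ) {c : Fin t → ℕ}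
    (hc : c ∈ typeCell q q a b₀) : localTypeFactor q a (fun i => (c i : ℤ)) = localTypeFactor q a b₀ := by
  rw [mem_typeCell] at hc
  unfold localTypeFactor
  refine Finset.prod_congr rfl fun p hp => ?_
  exact localFactor_sys_eq_of_incType_eq p (Nat.prime_of_mem_primeFactors hp) a _ _
    (hc.2 p hp (Nat.le_of_mem_primeFactors hp))

/-- Double counting of the pairs `(c, r)`, `c` in the cell, `r < q`, with every `a_i r + c_i` coprime to `q`. -/
theorem sum_card_filter_comm {q : ℕ} (a b₀ : Fin t → ℤ) :
    ∑ c ∈ typeCell q q a b₀, #((range q).filter (fun r : ℕ => ∀ i, Int.gcd (a i * r + c i) q = 1)) =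
      ∑ r ∈ range q, #((typeCell q q a b₀).filter (fun c => ∀ i, Int.gcd (a i * r + c i) q = 1)) := by
  simp_rw [Finset.card_filter]
  exact Finset.sum_comm

end SingularWeights

open SingularWeights in
/-- **(W5) THE COPRIME DENSITY ON A TYPE CLASS IS THE LOCAL FACTOR** (registered hook, fourth conjunct of
`SingularWeightFacts`): for `q ≥ 1` and every shift `n`,
`#{c ∈ class(b₀ mod q) : gcd(a_i n + c_i, q) = 1 ∀ i} · q^t = #class · φ(q)^t · ∏_{p ∣ q} β_p(a, b₀)`.
Sum the local identity `card_coprime_classes_eq` over the class (on which `∏_{p∣q} β_p(a, c)` is constant) and use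
that the coprime count on the class is the same at every `r` (translation invariance of the class). The hypotheses
`Squarefree q` and `a_i ≠ 0` of the registered statement are not needed. -/
theorem singularWeights_W5 : ∀ (t q : ℕ), 1 ≤ q → Squarefree q → ∀ a b₀ : Fin t → ℤ, (∀ i, a i ≠ 0) → ∀ n : ℕ, ((((typeCell q q a b₀).filter (fun c => ∀ i, Int.gcd (a i * n + c i) q = 1)).card : ℕ) : ℝ) * (q : ℝ) ^ t = ((typeCell q q a b₀).card : ℝ) * (Nat.totient q : ℝ) ^ t * localTypeFactor q a b₀ := by
  intro t q hq _ a b₀ _ n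
  have hq0 : 0 < q := hq
  have hqR : (q : ℝ) ≠ 0 := by exact_mod_cast hq0.ne'
  -- the local identity summed over the class
  have hsum : ∑ c ∈ typeCell q q a b₀,
      ((#((range q).filter (fun r : ℕ => ∀ i, Int.gcd (a i * r + c i) q = 1)) : ℕ) : ℝ) * (q : ℝ) ^ t =
      (#(typeCell q q a b₀) : ℝ) * ((q : ℝ) * (Nat.totient q : ℝ) ^ t * localTypeFactor q a b₀) := by
    calc ∑ c ∈ typeCell q q a b₀,
          ((#((range q).filter (fun r : ℕ => ∀ i, Int.gcd (a i * r + c i) q = 1)) : ℕ) : ℝ) * (q : ℝ) ^ t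
        = ∑ c ∈ typeCell q q a b₀, (q : ℝ) * (Nat.totient q : ℝ) ^ t * localTypeFactor q a (fun i => (c i : ℤ)) :=
          Finset.sum_congr rfl fun c _ => card_coprime_classes_eq q a (fun i => (c i : ℤ))
      _ = ∑ c ∈ typeCell q q a b₀, (q : ℝ) * (Nat.totient q : ℝ) ^ t * localTypeFactor q a b₀ :=
          Finset.sum_congr rfl fun c hc => by rw [localTypeFactor_eq_of_mem_typeCell a b₀ hc]
      _ = (#(typeCell q q a b₀) : ℝ) * ((q : ℝ) * (Nat.totient q : ℝ) ^ t * localTypeFactor q a b₀) := by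
          rw [Finset.sum_const, nsmul_eq_mul]
  -- the same sum, double counted, is `q` times the count at the shift `n`
  have hleft : ∑ c ∈ typeCell q q a b₀,
      ((#((range q).filter (fun r : ℕ => ∀ i, Int.gcd (a i * r + c i) q = 1)) : ℕ) : ℝ) * (q : ℝ) ^ t =
      (q : ℝ) * (#((typeCell q q a b₀).filter (fun c => ∀ i, Int.gcd (a i * n + c i) q = 1)) : ℝ) * (q : ℝ) ^ t := by
    rw [← Finset.sum_mul]
    congr 1
    rw [← Nat.cast_sum, sum_card_filter_comm a b₀,
      Finset.sum_congr rfl (fun (r : ℕ) _ => card_filter_coprime_eq hq0 a b₀ (r : ℤ) (n : ℤ)),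
      Finset.sum_const, Finset.card_range, smul_eq_mul, Nat.cast_mul]
  apply mul_left_cancel₀ hqR
  calc (q : ℝ) * (((#((typeCell q q a b₀).filter (fun c => ∀ i, Int.gcd (a i * n + c i) q = 1)) : ℕ) : ℝ) *
        (q : ℝ) ^ t)
      = (q : ℝ) * (#((typeCell q q a b₀).filter (fun c => ∀ i, Int.gcd (a i * n + c i) q = 1)) : ℝ) *
          (q : ℝ) ^ t := by ring
    _ = (#(typeCell q q a b₀) : ℝ) * ((q : ℝ) * (Nat.totient q : ℝ) ^ t * localTypeFactor q a b₀) :=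
        hleft.symm.trans hsum
    _ = (q : ℝ) * ((#(typeCell q q a b₀) : ℝ) * (Nat.totient q : ℝ) ^ t * localTypeFactor q a b₀) := by ring

end Summit.Parity.GeneralizedHardyLittlewood.Cruxes.RelativeDimOne.TypeSplit

end
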